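import Literature.Probability.RandomPlanarGeometry.HexSAWBridgeLength
import Literature.Probability.RandomPlanarGeometry.HexSAWKestenRenewal
import Mathlib.Topology.Algebra.InfiniteSum.Real
import Mathlib.Topology.Algebra.InfiniteSum.Constructions
import Mathlib.Algebra.BigOperators.Intervals
import HarnessLib

/-!
# Kesten's relation BY LENGTH on the hexagonal lattice: `Σ_n λ_n(ℍ) x_c^n = 1`

Topic `Literature/Probability/RandomPlanarGeometry` (continues `HexSAWBridgeLength.lean` and `HexSAWKestenRenewal.lean`).
Sources: H. Kesten, *On the number of self-avoiding walks*, J. Math. Phys. 4 (1963), §4 (on `ℤ^d`: `Σ_n λ_n μ^{-n} = 1`);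
N. Madras, G. Slade, *The Self-Avoiding Walk* (1993), eq. (4.2.4), p. 91; for the honeycomb lattice the relation is
STATED in N. R. Beaton, M. Bousquet-Mélou, J. de Gier, H. Duminil-Copin, A. J. Guttmann, *The critical fugacity for surface
adsorption of self-avoiding walks on the honeycomb lattice is `1 + √2`*, Comm. Math. Phys. 326 (2014), Appendix,
paragraph before Lemma 11: "Kesten's relation for irreducible bridges (see [MS93] or [Kesten63]) on the hypercubic
lattice `ℤ^d` can be easily adapted to the honeycomb lattice. It gives `Σ_{γ ∈ iSAB} x_c^{|γ|} = 1`."  Grouped by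
WIDTH this is the tree theorem `HV.hasSum_stripIlim` (`Σ_T I_T(x_c) = 1`, Duminil-Copin–Smirnov strip frame: bridges
crossing the strips `S_T` in the level direction, parallel to an edge class); this file regroups it by LENGTH (number of
vertices).  (In the perpendicular, rotated-honeycomb / brick-wall frame the relation is likewise stated without proof by
N. R. Beaton, J. Phys. A 47 (2014) 075003, Appendix, display before Lemma 16, and proved in the tree as
`HexBW.kestenRelation`; the two bridge families are inequivalent.)

PROVENANCE.  K87.1/K87.2 (the renewal equation by length, `HexSAWBridgeLengthRenewal.lean`, and Kesten's relation by
length, this file) were first kernel-checked in HOME by a-idea-1 (Sketch_G14_R87 ed.9, 2026-08-22); the proofs below are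
independent.

## Contents (namespace `Literature.Probability.RandomPlanarGeometry.SAW`)

* `length_le_card_stripV` — a bridge of `S_{T,L}` has at most `#V(S_{T,L})` vertices;
* `sum_range_card_mul_pow_eq` — `Σ_{n ≤ N} λ_{T,n} x^n = Σ_{l irreducible in S_{T,N}, |l| ≤ N} x^{|l|}` (box stability);
* `sum_card_mul_pow_le_stripIlim`, `stripI_le_sum_range` — the finite length sums of width `T` are squeezed between the
  `I_{T,L}(x_c)` and `I_T(x_c)`;
* `hasSum_card_length_width` — per width: `Σ_n λ_{T,n} x_c^n = I_T(x_c)` (monotone convergence in the box);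
* **`hasSum_hvIrrLen_mul_pow`** — `Σ_n λ_n(ℍ) x_c^n = 1` (Tonelli over (width, length) + `HV.hasSum_stripIlim`);
* **`hasSum_hvF`** — the half-length form `Σ_k λ_{2k}(ℍ) x_c^{2k} = 1` (odd lengths carry no bridge): Kesten's
  irreducible bridges at `x_c` form a PROBABILITY law by length — the recurrence input of the renewal theorem by length.
-/

noncomputable section

open Finset Filter Topology Literature.Probability.LatticeModels

namespace Literature.Probability.RandomPlanarGeometry.SAW

open HV

/- The strip finsets are closed computable terms whose definitional unfolding is astronomically expensive; they are sealed
for the unifier (membership goes through `HV.mem_bridgeLists_iff`). -/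
attribute [local irreducible] bridgeLists

/-! ### Lengths are bounded in a box -/

/-- A bridge of `S_{T,L}` is a self-avoiding list of vertices of `S_{T,L}`, so it has at most `#V(S_{T,L})` vertices.
[cite: DuminilCopinSmirnov2012, §2 ("a self-avoiding walk … visits each vertex at most once")] -/
theorem length_le_card_stripV {T L : ℕ} (hT : 1 ≤ T) {l : List HV} (hl : l ∈ bridgeLists T L) :
    l.length ≤ #(stripV T L) := by
  classical
  obtain ⟨-, -, hnd, hV, -, -⟩ := (mem_bridgeLists_iff hT).1 hl
  rw [← List.toFinset_card_of_nodup hnd]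
  exact card_le_card fun x hx => hV x (List.mem_toFinset.1 hx)

/-! ### Finite length sums of a fixed width -/

/-- On a length fibre the weight is constant: `Σ_{l : |l| = n} x^{|l|} = #{l : |l| = n} · x^n`. [folklore] -/
private theorem sum_filter_length_pow (A : Finset (List HV)) (n : ℕ) (x : ℝ) :
    ∑ l ∈ A.filter (fun l => l.length = n), x ^ l.length = (#(A.filter fun l => l.length = n) : ℝ) * x ^ n := by
  rw [sum_congr rfl fun l hl => by rw [(mem_filter.1 hl).2], sum_const, nsmul_eq_mul]

/-- **Box bookkeeping**: `Σ_{n ≤ N} λ_{T,n} x^n = Σ_{l irreducible in S_{T,N}, |l| ≤ N} x^{|l|}` — the length-`n` count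
(box `n`) is the length-`n` fibre of the box `N ≥ n`. [cite: Kesten1963SAW, §4; DuminilCopinSmirnov2012, §3] -/
theorem sum_range_card_mul_pow_eq {T : ℕ} (hT : 1 ≤ T) (N : ℕ) (x : ℝ) :
    ∑ n ∈ range (N + 1), (#((irrLists T n).filter fun l => l.length = n) : ℝ) * x ^ n
      = ∑ l ∈ (irrLists T N).filter (fun l => l.length ≤ N), x ^ l.length := by
  rw [← sum_fiberwise_of_maps_to (s := (irrLists T N).filter fun l => l.length ≤ N) (t := range (N + 1))
    (g := fun l => l.length) fun l hl => by
      simp only [mem_filter, mem_range] at hl ⊢; omega]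
  refine sum_congr rfl fun n hn => ?_
  rw [mem_range] at hn
  have hfib : ((irrLists T N).filter fun l => l.length ≤ N).filter (fun l => l.length = n)
      = (irrLists T n).filter fun l => l.length = n := by
    rw [filter_filter, ← filter_length_irrLists_eq hT (show n ≤ N by omega)]
    exact filter_congr fun l _ => ⟨fun h => h.2, fun h => ⟨by omega, h⟩⟩
  rw [hfib, sum_filter_length_pow]

/-- Every finite length sum of width `T` is at most `I_T(x_c)`. [cite: Kesten1963SAW, §4; DuminilCopinSmirnov2012, §3] -/
theorem sum_card_mul_pow_le_stripIlim {T : ℕ} (hT : 1 ≤ T) (s : Finset ℕ) :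
    ∑ n ∈ s, (#((irrLists T n).filter fun l => l.length = n) : ℝ) * hexCriticalFugacity ^ n ≤ stripIlim T := by
  have hx0 : 0 ≤ hexCriticalFugacity := hexCriticalFugacity_pos_lt_one.1.le
  set N := s.sup id with hN
  have hsub : s ⊆ range (N + 1) := fun n hn => by
    rw [mem_range]; exact Nat.lt_succ_of_le (le_sup (f := id) hn)
  calc ∑ n ∈ s, (#((irrLists T n).filter fun l => l.length = n) : ℝ) * hexCriticalFugacity ^ n
      ≤ ∑ n ∈ range (N + 1), (#((irrLists T n).filter fun l => l.length = n) : ℝ) * hexCriticalFugacity ^ n :=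
        sum_le_sum_of_subset_of_nonneg hsub fun _ _ _ => mul_nonneg (Nat.cast_nonneg _) (pow_nonneg hx0 _)
    _ = ∑ l ∈ (irrLists T N).filter (fun l => l.length ≤ N), hexCriticalFugacity ^ l.length :=
        sum_range_card_mul_pow_eq hT N _
    _ ≤ stripI T N hexCriticalFugacity :=
        sum_le_sum_of_subset_of_nonneg (filter_subset _ _) fun _ _ _ => pow_nonneg hx0 _
    _ ≤ stripIlim T := stripI_le_lim hT N

/-- Conversely `I_{T,L}(x_c) ≤ Σ_{n ≤ N} λ_{T,n} x_c^n` as soon as the box `N` contains `S_{T,L}` and exceeds all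
lengths there. [cite: Kesten1963SAW, §4; DuminilCopinSmirnov2012, §3] -/
theorem stripI_le_sum_range {T L N : ℕ} (hT : 1 ≤ T) (hL : L ≤ N) (hN : #(stripV T L) ≤ N) :
    stripI T L hexCriticalFugacity
      ≤ ∑ n ∈ range (N + 1), (#((irrLists T n).filter fun l => l.length = n) : ℝ) * hexCriticalFugacity ^ n := by
  have hx0 : 0 ≤ hexCriticalFugacity := hexCriticalFugacity_pos_lt_one.1.le
  rw [sum_range_card_mul_pow_eq hT N, stripI]
  refine sum_le_sum_of_subset_of_nonneg (fun l hl => ?_) fun _ _ _ => pow_nonneg hx0 _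
  rw [mem_filter]
  refine ⟨irrLists_mono_L hT hL hl, ?_⟩
  rw [irrLists, mem_filter] at hl
  exact (length_le_card_stripV hT hl.1).trans hN

/-- **Per width, by length**: `Σ_n λ_{T,n} x_c^n = I_T(x_c)` — the critical weight of the irreducible bridges of width
`T` of the infinite strip `S_T` is the sum of its length series (monotone convergence in the box `L`).
[cite: Kesten1963SAW, §4; DuminilCopinSmirnov2012, §3 (the limits `L → ∞`)] -/
theorem hasSum_card_length_width {T : ℕ} (hT : 1 ≤ T) :
    HasSum (fun n => (#((irrLists T n).filter fun l => l.length = n) : ℝ) * hexCriticalFugacity ^ n)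
      (stripIlim T) := by
  refine hasSum_of_isLUB_of_nonneg _
    (fun n => mul_nonneg (Nat.cast_nonneg _) (pow_nonneg hexCriticalFugacity_pos_lt_one.1.le _)) ⟨?_, fun b hb => ?_⟩
  · rintro _ ⟨s, rfl⟩
    exact sum_card_mul_pow_le_stripIlim hT s
  · refine ciSup_le fun L => ?_
    exact (stripI_le_sum_range hT (le_max_left L #(stripV T L)) (le_max_right _ _)).trans
      (hb ⟨range (max L #(stripV T L) + 1), rfl⟩)

/-! ### Kesten's relation by length -/

/-- **Kesten's relation by length on the hexagonal lattice**: `Σ_n λ_n(ℍ) x_c^n = 1` — Tonelli over (width, length)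
applied to `Σ_T I_T(x_c) = 1` (`HV.hasSum_stripIlim`) and `I_T = Σ_n λ_{T,n} x_c^n`.
[cite: BeatonBousquetMelouDeGierDuminilCopinGuttmann2014, Appendix, paragraph before Lemma 11; Kesten1963SAW, §4 (Thm. 5);
MadrasSlade1993, eq. (4.2.4), p. 91] -/
theorem hasSum_hvIrrLen_mul_pow : HasSum (fun n : ℕ => (hvIrrLen n : ℝ) * hexCriticalFugacity ^ n) 1 := by
  -- the double series, widths shifted by one
  obtain ⟨G, hG⟩ : ∃ G : ℕ × ℕ → ℝ,
      ∀ T n, (#((irrLists (T + 1) n).filter fun l => l.length = n) : ℝ) * hexCriticalFugacity ^ n = G (T, n) :=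
    ⟨fun p => (#((irrLists (p.1 + 1) p.2).filter fun l => l.length = p.2) : ℝ) * hexCriticalFugacity ^ p.2,
      fun _ _ => rfl⟩
  have hG0 : 0 ≤ G := fun p => by
    obtain ⟨T, n⟩ := p
    rw [← hG]
    exact mul_nonneg (Nat.cast_nonneg _) (pow_nonneg hexCriticalFugacity_pos_lt_one.1.le _)
  -- rows: width `T + 1`
  have hrow : ∀ T, HasSum (fun n => G (T, n)) (stripIlim (T + 1)) := fun T => by
    simpa only [hG] using hasSum_card_length_width (T := T + 1) (by omega)
  -- summability of the double series (nonnegative terms, summable rows, summable row sums)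
  have hsum : Summable G := by
    refine (summable_prod_of_nonneg hG0).2 ⟨fun T => (hrow T).summable, ?_⟩
    exact hasSum_stripIlim.summable.congr fun T => ((hrow T).tsum_eq).symm
  have hG1 : HasSum G 1 := by
    have h := hsum.hasSum
    rwa [HasSum.unique (h.prod_fiberwise hrow) hasSum_stripIlim] at h
  -- columns: length `n`, widths `T + 1 ≤ n` only
  have hswap : HasSum (G ∘ ⇑(Equiv.prodComm ℕ ℕ)) 1 := (Equiv.hasSum_iff _).2 hG1
  refine hswap.prod_fiberwise fun n => ?_
  simp only [Function.comp_apply, Equiv.prodComm_apply, Prod.swap_prod_mk]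
  have hvan : ∀ T ∉ range n, G (T, n) = 0 := fun T hT => by
    rw [mem_range, not_lt] at hT
    rw [← hG, filter_length_irrLists_eq_empty (by omega) (by omega), card_empty, Nat.cast_zero, zero_mul]
  have hfin : HasSum (fun T => G (T, n)) (∑ T ∈ range n, G (T, n)) := hasSum_sum_of_ne_finset_zero hvan
  have hval : ∑ T ∈ range n, G (T, n) = (hvIrrLen n : ℝ) * hexCriticalFugacity ^ n := by
    rw [hvIrrLen, Nat.cast_sum, sum_mul, range_eq_Ico, ← Finset.Ico_add_one_right_eq_Icc,
      ← sum_Ico_add' (fun T => (#((irrLists T n).filter fun l => l.length = n) : ℝ) * hexCriticalFugacity ^ n) 0 n 1]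
    exact sum_congr rfl fun T _ => (hG T n).symm
  rwa [hval] at hfin

/-- **Kesten's relation by half-length** (face K87.2 of the lane's R87 sketch): `Σ_k λ_{2k}(ℍ) x_c^{2k} = 1`, i.e.
`HasSum hvF 1` — the irreducible bridges at `x_c` form a probability law by (half-)length; odd lengths carry no bridge
(`hvIrrLen_odd`). [cite: BeatonBousquetMelouDeGierDuminilCopinGuttmann2014, Appendix, paragraph before Lemma 11;
Kesten1963SAW, §4; MadrasSlade1993, eq. (4.2.4), p. 91] -/
theorem hasSum_hvF : HasSum hvF 1 := by
  have hinj : Function.Injective fun k : ℕ => 2 * k := fun a b h => by simpa using h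
  have hoff : ∀ n ∉ Set.range (fun k : ℕ => 2 * k), (hvIrrLen n : ℝ) * hexCriticalFugacity ^ n = 0 := by
    intro n hn
    obtain ⟨m, rfl | rfl⟩ := Nat.even_or_odd' n
    · exact (hn ⟨m, rfl⟩).elim
    · rw [hvIrrLen_odd, Nat.cast_zero, zero_mul]
  exact (hinj.hasSum_iff hoff).2 hasSum_hvIrrLen_mul_pow

/-- `Σ_k f_k = 1` as a `tsum`. [cite: Kesten1963SAW, §4; MadrasSlade1993, eq. (4.2.4), p. 91] -/
theorem tsum_hvF : ∑' k, hvF k = 1 := hasSum_hvF.tsum_eq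

end Literature.Probability.RandomPlanarGeometry.SAW

end
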